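import Literature.AlgebraicGeometry.Resolution.CompleteFiniteness
import Literature.NumberTheory.EllipticCurves.IwasawaAlgebraPseudoNullProofs
import Mathlib.RingTheory.AdicCompletion.Noetherian
import Mathlib.RingTheory.Nakayama
import Mathlib.Algebra.CharP.Lemmas
import HarnessLib

/-!
# Class O1 (X5, `p = 2`, non-CM): the TOWER-GAP lemma, part 1 — ONE gap between two layers
# `X/(p, T^m)X` makes `X/pX` finite (lens-3 S-G4.0b in certificate form, PROVED, any prime)

HONEST FRAMING (cell `b2b-bsdres`, run/shared/lean/b2b/bsd-rank1-residual/, verbatim in every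
file): the goal of the cell is to DELETE the COMBINATION-SHAPED residual classes of the
Birch–Swinnerton-Dyer formula for ALL analytic-rank `≤ 1` elliptic curves over `ℚ` — "full BSD
formula for every rank `≤ 1` curve in class `C`" assembled STRICTLY from published theorems — so
that the rank-`≤ 1` remainder becomes exactly the CONSTRUCTION-SHAPED classes, which are TYPED
(missing-input `Prop`s), NOT attempted. This is not "finishing BSD". Research routes; no claim
beyond stated classes; census output = EVIDENCE, never a Literature fact; nothing here is booked;
no mark of RESIDUAL-MAP §I moves.

Unit `b2b-bsdres-cc-typer-4` (lane CLASS-CLOSURE, class O1), gen 3; o1 lead PLAN v2.5 C40/C44 queue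
item (2′) = lens-3 GEN 4 support **S-G4.0b `gapLemma_F2T`** in its DECISION form (ROUTES-O1 §lens-3
GEN 4, L3-10 `TowerGapMuCertificateAtTwo`: "K10 ⇒ `X(E/ℚ_∞)` torsion ∧ `μ₂ = 0`"). PURE ALGEBRA over
`Λ = ℤ_p⟦T⟧`, EVERY prime `p`, theorems only (plus the transparent abbreviations `towerIdeal`,
`omega`, `xPowSubmodule`, `modPSubmodule`, `quotientTowerIdealEquiv`; no `Prop`-valued def, no
named fact). Part 2 (`X5/TwoAdicTargetsTowerGapEnd.lean`): `X/pX` finite ⇒ `X` torsion ∧ `μ = 0`,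
and the O1 consumer at `p = 2`.

* `towerIdeal p m = (p) + (T)^m = (p, T^m)`; `𝔪_Λ^m ⊆ (p, T^m)` (`maximalIdeal_pow_le_towerIdeal`),
  hence **`X/(p, T^m)X` is finite for `X` finitely generated** (`finite_quotient_towerIdeal`) — the
  layer counts of the certificate are honest natural numbers.
* **`(p, ω_n) = (p, T^{pⁿ})`** for `ω_n = (1 + T)^{pⁿ} − 1` (`span_C_p_sup_span_omega_eq_towerIdeal`,
  from `(1 + T)^{pⁿ} = 1 + T^{pⁿ} + p·T·r`): so `#X/(p, T^{pⁿ})X = #X/(p, ω_n)X = #(X/pX)_{Γ_n}`, the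
  order of the Pontryagin dual of `Sel(ℚ_∞, E[p^∞])[p]^{Γ_n}` — lens-3's `2^{d_n}`.
* **The gap lemma** (`finite_of_card_quotient_lt`): `N` finitely generated over `Λ` and killed by
  `p`, `m k : ℕ`, `N/T^{m+k}N` finite and `#(N/T^{m+k}N) < p^k · #(N/T^m N)` ⇒ `N` FINITE. Proof
  without the structure theorem: the chain `T^m N ⊇ ⋯ ⊇ T^{m+k} N` has `k` steps; a PROPER step has
  index divisible by `p` (a non-zero class in a group killed by `p` has order `p`,
  `dvd_relIndex_of_lt`), so if all were proper `p^k ∣ [T^m N : T^{m+k} N] < p^k`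
  (`pow_dvd_relIndex_of_forall_lt`), absurd; hence some `T^{j+1} N = T^j N`, so `T^j N = 0` by
  Nakayama (`T ∈ 𝔪_Λ`; `xPowSubmodule_eq_bot_of_eq_succ`), `T^{m+k} N ⊆ T^j N = 0`, and
  `N ≅ N/T^{m+k}N`. (lens-3's `d_n = t·2ⁿ + Σ min(aᵢ, 2ⁿ)`, `gap_n ≥ t·2ⁿ ⇒ (gap_n < 2ⁿ ⇒ t = 0)`
  is the structure-theorem reading of the same count at `m = k = 2ⁿ`.)
* **From the layers of `X` to `X/pX`** (`finite_modP_of_card_quotient_lt`): for `X` finitely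
  generated, `X/(p, T^j)X ≅ (X/pX)/T^j(X/pX)` (`quotientTowerIdealEquiv`, third isomorphism), so
  ONE gap `#(X/(p,T^{m+k})X) < p^k · #(X/(p,T^m)X)` makes `X/pX` finite.

References: R. Greenberg, LNM 1716 (1999), §3 (the elements `ω_n`), p. 136 l. 3 (`λ + μ ≥ dim X/𝔪X`,
the `n = 0` shadow of the layer count); L. Washington, *Introduction to Cyclotomic Fields*, §13.2;
J. Neukirch, A. Schmidt, K. Wingberg, *Cohomology of Number Fields*, (5.1.4) Remark 4 (`Λ/𝔪ʳ`
finite); T. Fukuda, Proc. Japan Acad. 70 (1994) (layer stabilisation for class groups — the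
dictionary source of L3-10).
-/

set_option autoImplicit false

noncomputable section

open scoped Classical Pointwise

open Literature.NumberTheory.EllipticCurves IsLocalRing

/-! ## Part A — pure algebra over `Λ = ℤ_p⟦T⟧`, any prime `p` -/

namespace Summit.BirchSwinnertonDyer.Rank1Residual.X5.TowerGap

variable (p : ℕ) [hp : Fact p.Prime]

/-! ### §A.1 The ideals `(p, T^m)` and `(p, ω_n)` -/

/-- `towerIdeal p m = (p) + (T)^m = (p, T^m) ⊆ Λ = ℤ_p⟦T⟧`; `X/(p, T^{pⁿ})X = X/(p, ω_n)X` is the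
`n`-th layer quotient of `X/pX` (`span_C_p_sup_span_omega_eq_towerIdeal`). [folklore] -/
def towerIdeal (m : ℕ) : Ideal (IwasawaAlgebra p) :=
  Ideal.span {(PowerSeries.C (p : ℤ_[p]) : IwasawaAlgebra p)} ⊔
    Ideal.span {(PowerSeries.X : IwasawaAlgebra p)} ^ m

/-- `towerIdeal p m = (p, T^m)` as a two-generator span. [folklore] -/
theorem towerIdeal_eq_span_pair (m : ℕ) :
    towerIdeal p m = Ideal.span {(PowerSeries.C (p : ℤ_[p]) : IwasawaAlgebra p),
      (PowerSeries.X : IwasawaAlgebra p) ^ m} := by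
  rw [towerIdeal, Ideal.span_singleton_pow, Ideal.span_insert]

/-- `(p, T^{m'}) ⊆ (p, T^m)` for `m ≤ m'`. [folklore] -/
theorem towerIdeal_anti {m m' : ℕ} (h : m ≤ m') : towerIdeal p m' ≤ towerIdeal p m :=
  sup_le_sup_left (Ideal.pow_le_pow_right h) _

/-- `(I + J)^m ⊆ I + J^m` for ideals of a commutative ring. [folklore] -/
theorem sup_pow_le_sup_pow {R : Type*} [CommSemiring R] (I J : Ideal R) (m : ℕ) :
    (I ⊔ J) ^ m ≤ I ⊔ J ^ m := by
  induction m with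
  | zero => rw [pow_zero, pow_zero]; exact le_sup_right
  | succ m ih =>
    rw [pow_succ, pow_succ]
    refine (Ideal.mul_mono_left ih).trans ?_
    rw [Ideal.mul_sup]
    refine sup_le (Ideal.mul_le_left.trans le_sup_left) ?_
    rw [Ideal.sup_mul]
    exact sup_le (Ideal.mul_le_right.trans le_sup_left) le_sup_right

/-- `𝔪_Λ ⊆ (p, T)`: a non-unit power series over `ℤ_p` has constant term in `pℤ_p` and
`f = f(0) + T · g`. [folklore] -/
theorem maximalIdeal_le_towerIdeal_one :
    maximalIdeal (IwasawaAlgebra p) ≤ towerIdeal p 1 := by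
  intro f hf
  rw [towerIdeal, pow_one]
  have hf0 : PowerSeries.constantCoeff f ∈ maximalIdeal ℤ_[p] := by
    rw [mem_maximalIdeal, mem_nonunits_iff] at hf ⊢
    exact fun h => hf (PowerSeries.isUnit_iff_constantCoeff.mpr h)
  rw [PadicInt.maximalIdeal_eq_span_p, Ideal.mem_span_singleton'] at hf0
  obtain ⟨c, hc⟩ := hf0
  rw [PowerSeries.eq_X_mul_shift_add_const f, sup_comm]
  -- the two summands of `eq_X_mul_shift_add_const` come in the order `X * g + C f(0)`
  refine Submodule.add_mem_sup ?_ ?_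
  · exact Ideal.mul_mem_right _ _ (Ideal.mem_span_singleton_self _)
  · rw [← hc, map_mul]
    exact Ideal.mul_mem_left _ _ (Ideal.mem_span_singleton_self _)

/-- `𝔪_Λ^m ⊆ (p, T^m)`. [folklore] -/
theorem maximalIdeal_pow_le_towerIdeal (m : ℕ) :
    maximalIdeal (IwasawaAlgebra p) ^ m ≤ towerIdeal p m := by
  refine (Ideal.pow_right_mono (maximalIdeal_le_towerIdeal_one p) m).trans ?_
  rw [towerIdeal, pow_one, towerIdeal]
  exact sup_pow_le_sup_pow _ _ m

/-- `ω_n := (1 + T)^{pⁿ} − 1 ∈ Λ` (`γ^{pⁿ} − 1` for `γ ↦ 1 + T`), the element cutting out the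
`Γ_n`-coinvariants `X/ω_n X`. Greenberg (1999), §3. [cite: GreenbergLNM1716, §3 (pp. 85–91)] -/
def omega (n : ℕ) : IwasawaAlgebra p :=
  (1 + PowerSeries.X) ^ p ^ n - 1

/-- `ω_n ≡ T^{pⁿ} (mod p)`: `ω_n − T^{pⁿ} ∈ (p)` (`(1 + T)^{pⁿ} = 1 + T^{pⁿ} + p·T·r`).
[folklore] -/
theorem omega_sub_X_pow_mem (n : ℕ) :
    omega p n - PowerSeries.X ^ p ^ n ∈
      Ideal.span {(PowerSeries.C (p : ℤ_[p]) : IwasawaAlgebra p)} := by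
  obtain ⟨r, hr⟩ := exists_add_pow_prime_pow_eq hp.out (1 : IwasawaAlgebra p) PowerSeries.X n
  rw [omega, hr, one_pow, map_natCast]
  refine Ideal.mem_span_singleton'.mpr ⟨PowerSeries.X * r, ?_⟩
  ring

/-- **`(p, ω_n) = (p, T^{pⁿ})`**: the `n`-th layer quotient `X/(p, ω_n)X = (X/pX)_{Γ_n}` is
`X/(p, T^{pⁿ})X`. [folklore] -/
theorem span_C_p_sup_span_omega_eq_towerIdeal (n : ℕ) :
    Ideal.span {(PowerSeries.C (p : ℤ_[p]) : IwasawaAlgebra p)} ⊔ Ideal.span {omega p n} =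
      towerIdeal p (p ^ n) := by
  rw [towerIdeal, Ideal.span_singleton_pow]
  have hmem := omega_sub_X_pow_mem p n
  apply le_antisymm
  · refine sup_le le_sup_left (Ideal.span_le.mpr (Set.singleton_subset_iff.mpr ?_))
    have : omega p n = (omega p n - PowerSeries.X ^ p ^ n) + PowerSeries.X ^ p ^ n := by ring
    rw [this]
    exact Submodule.add_mem_sup hmem (Ideal.mem_span_singleton_self _)
  · refine sup_le le_sup_left (Ideal.span_le.mpr (Set.singleton_subset_iff.mpr ?_))
    have : (PowerSeries.X : IwasawaAlgebra p) ^ p ^ n =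
        -(omega p n - PowerSeries.X ^ p ^ n) + omega p n := by ring
    rw [this]
    exact Submodule.add_mem_sup (Submodule.neg_mem _ hmem) (Ideal.mem_span_singleton_self _)

/-! ### §A.2 Finiteness of the layer quotients `X/(p, T^m)X` -/

variable {M : Type*} [AddCommGroup M] [Module (IwasawaAlgebra p) M]

/-- For `M` finitely generated over `Λ` and an ideal `J ⊇ 𝔪^n`, `M/JM` is finite (it is a finitely
generated module over the finite ring `Λ/𝔪^n`). [cite: NeukirchSchmidtWingberg2008, Ch. V §1, (5.1.4) Remark 4] -/
theorem finite_quotient_smul_of_maximalIdeal_pow_le [Module.Finite (IwasawaAlgebra p) M]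
    {J : Ideal (IwasawaAlgebra p)} {n : ℕ} (hJ : maximalIdeal (IwasawaAlgebra p) ^ n ≤ J) :
    Finite (M ⧸ (J • ⊤ : Submodule (IwasawaAlgebra p) M)) := by
  set 𝔪 := maximalIdeal (IwasawaAlgebra p)
  have htors : Module.IsTorsionBySet (IwasawaAlgebra p)
      (M ⧸ (J • ⊤ : Submodule (IwasawaAlgebra p) M)) ↑(𝔪 ^ n) := by
    rintro x ⟨a, ha⟩
    induction x using Submodule.Quotient.induction_on with
    | H x =>
      change a • Submodule.Quotient.mk x = (0 : M ⧸ (J • ⊤ : Submodule (IwasawaAlgebra p) M))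
      rw [← Submodule.Quotient.mk_smul, Submodule.Quotient.mk_eq_zero]
      exact Submodule.smul_mem_smul (hJ ha) Submodule.mem_top
  letI := htors.module
  haveI : IsScalarTower (IwasawaAlgebra p) (IwasawaAlgebra p ⧸ 𝔪 ^ n)
      (M ⧸ (J • ⊤ : Submodule (IwasawaAlgebra p) M)) := htors.isScalarTower
  haveI : Module.Finite (IwasawaAlgebra p ⧸ 𝔪 ^ n)
      (M ⧸ (J • ⊤ : Submodule (IwasawaAlgebra p) M)) :=
    Module.Finite.of_restrictScalars_finite (IwasawaAlgebra p) _ _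
  haveI := IwasawaAlgebra.finite_quotient_maximalIdeal_pow p n
  exact Module.finite_of_finite (IwasawaAlgebra p ⧸ 𝔪 ^ n)

/-- **`X/(p, T^m)X` is finite** for `X` finitely generated over `Λ` (so the layer counts of the
certificate are honest natural numbers). [folklore] -/
theorem finite_quotient_towerIdeal [Module.Finite (IwasawaAlgebra p) M] (m : ℕ) :
    Finite (M ⧸ (towerIdeal p m • ⊤ : Submodule (IwasawaAlgebra p) M)) :=
  finite_quotient_smul_of_maximalIdeal_pow_le p (maximalIdeal_pow_le_towerIdeal p m)

/-! ### §A.3 The gap lemma for a finitely generated `Λ`-module killed by `p` -/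

/-- In an additive group killed by the prime `p`, a PROPER inclusion of subgroups `A < B` has
relative index divisible by `p` (a class `x + A`, `x ∈ B ∖ A`, has order exactly `p`; infinite
index is `0`). [folklore] -/
theorem dvd_relIndex_of_lt {G : Type*} [AddCommGroup G] (hG : ∀ g : G, p • g = 0)
    {A B : AddSubgroup G} (hAB : A < B) : p ∣ A.relIndex B := by
  obtain ⟨-, x, hxB, hxA⟩ := SetLike.lt_iff_le_and_exists.mp hAB
  set c : B ⧸ A.addSubgroupOf B := ((⟨x, hxB⟩ : B) : B ⧸ A.addSubgroupOf B) with hc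
  have hc0 : c ≠ 0 := by
    intro h
    rw [hc, QuotientAddGroup.eq_zero_iff, AddSubgroup.mem_addSubgroupOf] at h
    exact hxA h
  have hpc : p • c = 0 := by
    have hx0 : p • (⟨x, hxB⟩ : B) = 0 := Subtype.ext (by simpa using hG x)
    rw [hc, ← QuotientAddGroup.mk_nsmul, hx0, QuotientAddGroup.mk_zero]
  have hord : addOrderOf c = p := addOrderOf_eq_prime hpc hc0
  rw [AddSubgroup.relIndex, AddSubgroup.index, ← hord]
  exact addOrderOf_dvd_natCard c

/-- Chains: if `k` consecutive steps `S (m+j+1) < S (m+j)` (`j < k`) of an antitone chain of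
subgroups of a group killed by `p` are all PROPER, then `p^k` divides the relative index
`[S m : S (m+k)]`. [folklore] -/
theorem pow_dvd_relIndex_of_forall_lt {G : Type*} [AddCommGroup G] (hG : ∀ g : G, p • g = 0)
    (S : ℕ → AddSubgroup G) (hS : Antitone S) (m k : ℕ)
    (hlt : ∀ j < k, S (m + j + 1) < S (m + j)) : p ^ k ∣ (S (m + k)).relIndex (S m) := by
  induction k with
  | zero => simp
  | succ k ih =>
    have h1 : p ^ k ∣ (S (m + k)).relIndex (S m) := ih fun j hj => hlt j (Nat.lt_succ_of_lt hj)
    have h2 : p ∣ (S (m + k + 1)).relIndex (S (m + k)) :=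
      dvd_relIndex_of_lt p hG (hlt k k.lt_succ_self)
    change p ^ (k + 1) ∣ (S (m + k + 1)).relIndex (S m)
    rw [pow_succ', ← AddSubgroup.relIndex_mul_relIndex _ _ _ (hS (Nat.le_succ (m + k)))
      (hS (Nat.le_add_right m k))]
    exact mul_dvd_mul h2 h1

/-- The `T`-power filtration `T^j N` of a `Λ`-module. [folklore] -/
def xPowSubmodule (N : Type*) [AddCommGroup N] [Module (IwasawaAlgebra p) N] (j : ℕ) :
    Submodule (IwasawaAlgebra p) N :=
  Ideal.span {(PowerSeries.X : IwasawaAlgebra p)} ^ j • ⊤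

/-- `T^j N` decreases with `j`. [folklore] -/
theorem xPowSubmodule_antitone (N : Type*) [AddCommGroup N] [Module (IwasawaAlgebra p) N] :
    Antitone (xPowSubmodule p N) := fun _ _ h =>
  Submodule.smul_mono_left (Ideal.pow_le_pow_right h)

/-- `T ∈ 𝔪_Λ`, so `(T)` lies in the Jacobson radical of `Λ`. [folklore] -/
theorem span_X_le_jacobson_bot :
    Ideal.span {(PowerSeries.X : IwasawaAlgebra p)} ≤ (⊥ : Ideal (IwasawaAlgebra p)).jacobson := by
  rw [jacobson_eq_maximalIdeal ⊥ bot_ne_top, Ideal.span_le, Set.singleton_subset_iff,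
    SetLike.mem_coe, mem_maximalIdeal, mem_nonunits_iff, PowerSeries.isUnit_iff_constantCoeff]
  simp

/-- Nakayama: `T^{j+1} N = T^j N` with `N` finitely generated forces `T^j N = 0`. [folklore] -/
theorem xPowSubmodule_eq_bot_of_eq_succ {N : Type*} [AddCommGroup N] [Module (IwasawaAlgebra p) N]
    [Module.Finite (IwasawaAlgebra p) N] {j : ℕ}
    (h : xPowSubmodule p N (j + 1) = xPowSubmodule p N j) : xPowSubmodule p N j = ⊥ := by
  refine Submodule.eq_bot_of_le_smul_of_le_jacobson_bot (Ideal.span {PowerSeries.X})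
    (xPowSubmodule p N j) (IsNoetherian.noetherian _) ?_ (span_X_le_jacobson_bot p)
  change Ideal.span {PowerSeries.X} ^ j • (⊤ : Submodule (IwasawaAlgebra p) N) ≤
    Ideal.span {PowerSeries.X} • (Ideal.span {PowerSeries.X} ^ j • ⊤)
  rw [← Submodule.mul_smul, ← pow_succ']
  exact h.symm.le

/-- `#(N/S) = [N : S]` (the module quotient by a submodule IS the group quotient by its underlying
subgroup). [folklore] -/
theorem natCard_quotient_eq_index {R N : Type*} [Ring R] [AddCommGroup N] [Module R N]
    (S : Submodule R N) : Nat.card (N ⧸ S) = S.toAddSubgroup.index := rfl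

/-- **The gap lemma (S-G4.0b (G), certificate form).** Let `N` be a finitely generated
`Λ = ℤ_p⟦T⟧`-module killed by `p`, and `m k : ℕ`. If `N/T^{m+k}N` is finite and
`#(N/T^{m+k}N) < p^k · #(N/T^m N)`, then `N` is finite. (Some step of
`T^m N ⊇ ⋯ ⊇ T^{m+k} N` is not proper — otherwise `p^k ∣ [T^m N : T^{m+k} N] < p^k` — so
Nakayama kills `T^j N` for some `j ≤ m + k`, and `N ≅ N/T^{m+k}N`.) For
`N/2N ≅ 𝔽₂⟦T⟧^t ⊕ ⊕ 𝔽₂⟦T⟧/(T^{aᵢ})` this is lens-3's "`gap_n ≥ t·2ⁿ`, so `gap_n < 2ⁿ ⇒ t = 0`"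
at `m = k = 2ⁿ`, without the structure theorem. [folklore] -/
theorem finite_of_card_quotient_lt {N : Type*} [AddCommGroup N] [Module (IwasawaAlgebra p) N]
    [Module.Finite (IwasawaAlgebra p) N] (hN : ∀ x : N, p • x = 0) (m k : ℕ)
    (hfin : Finite (N ⧸ xPowSubmodule p N (m + k)))
    (hlt : Nat.card (N ⧸ xPowSubmodule p N (m + k)) <
      p ^ k * Nat.card (N ⧸ xPowSubmodule p N m)) : Finite N := by
  set S := xPowSubmodule p N with hSdef
  have hanti : Antitone S := xPowSubmodule_antitone p N
  -- indices
  rw [natCard_quotient_eq_index, natCard_quotient_eq_index] at hlt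
  have hne : (S (m + k)).toAddSubgroup.index ≠ 0 := by
    rw [← natCard_quotient_eq_index]; exact Nat.card_pos.ne'
  have hle : (S (m + k)).toAddSubgroup ≤ (S m).toAddSubgroup := fun x hx => hanti (Nat.le_add_right m k) hx
  have hmul := AddSubgroup.relIndex_mul_index hle
  set r := (S (m + k)).toAddSubgroup.relIndex (S m).toAddSubgroup with hrdef
  have hr0 : r ≠ 0 := fun h => hne (by rw [← hmul, h, zero_mul])
  have hrlt : r < p ^ k := by
    rw [← hmul] at hlt
    exact Nat.lt_of_mul_lt_mul_right hlt
  -- some step is not proper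
  have hstep : ∃ j < k, S (m + j + 1) = S (m + j) := by
    by_contra hcon
    push Not at hcon
    have hlt' : ∀ j < k, (S (m + j + 1)).toAddSubgroup < (S (m + j)).toAddSubgroup := by
      intro j hj
      refine lt_of_le_of_ne (fun x hx => hanti (Nat.le_succ _) hx) fun h => hcon j hj ?_
      exact Submodule.toAddSubgroup_injective h
    have hdvd := pow_dvd_relIndex_of_forall_lt p hN (fun j => (S j).toAddSubgroup)
      (fun a b hab x hx => hanti hab hx) m k hlt'
    exact absurd (Nat.le_of_dvd (Nat.pos_of_ne_zero hr0) hdvd) (not_le.mpr hrlt)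
  obtain ⟨j, hj, hjeq⟩ := hstep
  have hbot : S (m + j) = ⊥ := xPowSubmodule_eq_bot_of_eq_succ p hjeq
  have hbot' : S (m + k) = ⊥ :=
    le_bot_iff.mp ((hanti (Nat.add_le_add_left hj.le m)).trans hbot.le)
  exact Finite.of_equiv _ (Submodule.quotEquivOfEqBot _ hbot').toEquiv

/-! ### §A.4 From the layers of `X` to `X/pX` -/

/-- `pX ⊆ X` as a `Λ`-submodule: `(p) • X`. [folklore] -/
def modPSubmodule (M : Type*) [AddCommGroup M] [Module (IwasawaAlgebra p) M] :
    Submodule (IwasawaAlgebra p) M :=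
  Ideal.span {(PowerSeries.C (p : ℤ_[p]) : IwasawaAlgebra p)} • ⊤

/-- `X/pX` is killed by `p`. [folklore] -/
theorem nsmul_p_quotient_modP (x : M ⧸ modPSubmodule p M) : p • x = 0 := by
  induction x using Submodule.Quotient.induction_on with
  | H x =>
    -- `p • mk x` is `mk (p • x)` by `rfl`; `p • x = C(p) • x ∈ (p) • X`
    have h : (Submodule.Quotient.mk (p • x) : M ⧸ modPSubmodule p M) = 0 := by
      rw [Submodule.Quotient.mk_eq_zero, ← Nat.cast_smul_eq_nsmul (IwasawaAlgebra p),
        ← map_natCast (PowerSeries.C (R := ℤ_[p])) p]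
      exact Submodule.smul_mem_smul (Ideal.mem_span_singleton_self _) Submodule.mem_top
    exact h

/-- **`X/(p, T^j)X ≅ (X/pX)/T^j(X/pX)`** (third isomorphism theorem). [folklore] -/
def quotientTowerIdealEquiv (j : ℕ) :
    (M ⧸ (towerIdeal p j • ⊤ : Submodule (IwasawaAlgebra p) M)) ≃ₗ[IwasawaAlgebra p]
      ((M ⧸ modPSubmodule p M) ⧸ xPowSubmodule p (M ⧸ modPSubmodule p M) j) := by
  refine (Submodule.quotEquivOfEq _ _ ?_).trans
    (Submodule.quotientQuotientEquivQuotientSup (modPSubmodule p M)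
      (Ideal.span {(PowerSeries.X : IwasawaAlgebra p)} ^ j • ⊤)).symm |>.trans
    (Submodule.quotEquivOfEq _ _ ?_)
  · rw [towerIdeal, Submodule.sup_smul, modPSubmodule]
  · rw [xPowSubmodule, Submodule.map_smul'', Submodule.map_top, Submodule.range_mkQ]

/-- **One gap between two layers of `X` makes `X/pX` finite**: for `X` finitely generated over
`Λ` and `m k : ℕ`, `#(X/(p,T^{m+k})X) < p^k · #(X/(p,T^m)X) ⇒ X/pX` finite. [folklore] -/
theorem finite_modP_of_card_quotient_lt [Module.Finite (IwasawaAlgebra p) M] (m k : ℕ)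
    (hlt : Nat.card (M ⧸ (towerIdeal p (m + k) • ⊤ : Submodule (IwasawaAlgebra p) M)) <
      p ^ k * Nat.card (M ⧸ (towerIdeal p m • ⊤ : Submodule (IwasawaAlgebra p) M))) :
    Finite (M ⧸ modPSubmodule p M) := by
  have hfin := finite_quotient_towerIdeal p (M := M) (m + k)
  rw [Nat.card_congr (quotientTowerIdealEquiv p (M := M) (m + k)).toEquiv,
    Nat.card_congr (quotientTowerIdealEquiv p (M := M) m).toEquiv] at hlt
  exact finite_of_card_quotient_lt p (nsmul_p_quotient_modP p (M := M)) m k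
    (Finite.of_equiv _ (quotientTowerIdealEquiv p (M := M) (m + k)).toEquiv) hlt

end Summit.BirchSwinnertonDyer.Rank1Residual.X5.TowerGap
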